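import Mathlib
import Literature.NumberTheory.Automorphic.ShimuraCurve
import Literature.NumberTheory.Automorphic.QuaternionEuclideanEmbedding
import Literature.NumberTheory.Automorphic.QuaternionAlgebraClassification
import HarnessLib

/-!
# The group `Γ₀^D(M) = ι(O¹)` of a Shimura curve datum is discrete; `ι(O)` is a lattice of `M₂(ℝ)`
# (Vignéras, LNM 800, Ch. IV §1 Thm. 1.1 (1))

Topic `NumberTheory/Automorphic`; theorems only (no definition, no named fact, no instance). For
a Shimura curve datum `X` of level `(D, M)` (`ShimuraCurve.lean`: a quaternion algebra `B/ℚ`, an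
Eichler order `O`, an injective real splitting `ι : B →ₐ[ℚ] M₂(ℝ)`):

1. `span_real_range_eq_top` — **`ℝ · ι(B) = M₂(ℝ)`**: `ι` induces an `ℝ`-algebra map
   `ℝ ⊗_ℚ B → M₂(ℝ)`, injective because `ℝ ⊗_ℚ B` is simple (a quaternion algebra over `ℝ`,
   tree `isQuaternionAlgebra_scalarExtension`), hence bijective by dimension `4 = 4`.
2. `ShimuraCurveData.exists_basis_coe_span_eq` — **`ι(O)` is a full `ℤ`-lattice of `M₂(ℝ)`**:
   the image under `ι` of a `ℤ`-basis of `O` (tree `IsFullLattice.nonempty_basis_fin_four`) is an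
   `ℝ`-basis `b` of `M₂(ℝ)` with `ℤ`-span `ι(O)`.
3. `ShimuraCurveData.isDiscreteSubgroup_Gamma` — **Vignéras IV Thm. 1.1 (1): `ι(O¹)` is a
   discrete subgroup of `SL₂(ℝ)`** (tree `IsDiscreteSubgroup`: finitely many elements in each
   norm ball), since a bounded set meets the lattice `ι(O)` in finitely many points (Mathlib
   `ZSpan.setFinite_inter`).

Brick "S3a" of the `D > 1` branch of the proof of
`Literature.NumberTheory.Automorphic.ShimuraCurveData.volume_fd_eq` (Eichler's lattice-point method
needs `ι(O)` as a `ℤ`-lattice of `M₂(ℝ)` and the discreteness of `Γ` for Dirichlet domains).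

## References

* M.-F. Vignéras, *Arithmétique des algèbres de quaternions*, LNM 800 (1980), Ch. IV §1
  Thm. 1.1 [VignerasLNM800].
-/

noncomputable section

open Matrix
open scoped TensorProduct Matrix.Norms.Elementwise

namespace Literature.NumberTheory.Automorphic

/-! ### 1. `ℝ · ι(B) = M₂(ℝ)` -/

section RealSpan

variable {B : Type*} [Ring B] [Algebra ℚ B] [IsQuaternionAlgebra ℚ B]

/-- **A real splitting spans `M₂(ℝ)` over `ℝ`**: for an injective `ℚ`-algebra map
`ι : B → M₂(ℝ)` of a quaternion algebra `B/ℚ`, the `ℝ`-span of `ι(B)` is all of `M₂(ℝ)`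
(`ℝ ⊗_ℚ B → M₂(ℝ)` is an injective map of `4`-dimensional `ℝ`-algebras, `ℝ ⊗_ℚ B` being simple).
[cite: VignerasLNM800, Ch. IV §1 (H ⊗ ℝ ≅ M(2,ℝ))] -/
theorem span_real_range_eq_top (ι : B →ₐ[ℚ] Matrix (Fin 2) (Fin 2) ℝ) :
    Submodule.span ℝ (Set.range ι) = ⊤ := by
  -- the induced `ℝ`-algebra map on `ℝ ⊗_ℚ B`
  let f : ℝ ⊗[ℚ] B →ₐ[ℝ] Matrix (Fin 2) (Fin 2) ℝ :=
    Algebra.TensorProduct.lift (Algebra.ofId ℝ (Matrix (Fin 2) (Fin 2) ℝ)) ι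
      (fun r b => Algebra.commutes r (ι b))
  haveI hQ : IsQuaternionAlgebra ℝ (ScalarExtension ℚ ℝ B) := isQuaternionAlgebra_scalarExtension ℚ B ℝ
  haveI : IsSimpleRing (ℝ ⊗[ℚ] B) := IsQuaternionAlgebra.isSimpleRing' ℝ (ScalarExtension ℚ ℝ B)
  have hfin : Module.finrank ℝ (ℝ ⊗[ℚ] B) = Module.finrank ℝ (Matrix (Fin 2) (Fin 2) ℝ) := by
    rw [Module.finrank_baseChange, IsQuaternionAlgebra.finrank_eq_four (K := ℚ) (D := B),
      Module.finrank_matrix]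
    simp
  have hinj : Function.Injective f := RingHom.injective f.toRingHom
  have hsurj : Function.Surjective f :=
    (LinearMap.injective_iff_surjective_of_finrank_eq_finrank hfin (f := f.toLinearMap)).mp hinj
  -- the range of `f` is the `ℝ`-span of `ι(B)`
  refine Submodule.eq_top_iff'.mpr fun y => ?_
  obtain ⟨t, rfl⟩ := hsurj y
  induction t using TensorProduct.induction_on with
  | zero => rw [map_zero]; exact zero_mem _
  | tmul r b =>
    have : f (r ⊗ₜ[ℚ] b) = r • ι b := by
      change Algebra.TensorProduct.lift _ _ _ (r ⊗ₜ[ℚ] b) = _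
      rw [Algebra.TensorProduct.lift_tmul, Algebra.ofId_apply, ← Algebra.smul_def]
    rw [this]
    exact Submodule.smul_mem _ r (Submodule.subset_span ⟨b, rfl⟩)
  | add x y hx hy => rw [map_add]; exact add_mem hx hy

end RealSpan

/-! ### 2. `ι(O)` is a `ℤ`-lattice of `M₂(ℝ)` -/

variable {D M : ℕ}

/-- **`ι(O)` is a full `ℤ`-lattice of `M₂(ℝ)`**: there is an `ℝ`-basis `b` of `M₂(ℝ)` (the image of
a `ℤ`-basis of the Eichler order `O`) whose `ℤ`-span is `ι(O)`. [cite: VignerasLNM800, Ch. IV §1 Thm. 1.1 (1)] -/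
theorem ShimuraCurveData.exists_basis_coe_span_eq (X : ShimuraCurveData D M) :
    ∃ b : Module.Basis (Fin 4) ℝ (Matrix (Fin 2) (Fin 2) ℝ),
      (Submodule.span ℤ (Set.range b) : Set (Matrix (Fin 2) (Fin 2) ℝ)) = X.ι '' (X.O : Set X.B) := by
  have hfull : IsFullLattice X.B X.O := X.isOrder.isFullLattice
  obtain ⟨bO⟩ := hfull.nonempty_basis_fin_four
  haveI := isLocalizedModule_subtype_of_isFullLattice hfull
  let bQ : Module.Basis (Fin 4) ℚ X.B := bO.ofIsLocalizedModule ℚ (nonZeroDivisors ℤ) X.O.subtype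
  have hbQ : ∀ i, bQ i = (bO i : X.B) := fun i => by
    rw [Module.Basis.ofIsLocalizedModule_apply]; rfl
  -- the images `v i = ι (bO i)` span `M₂(ℝ)` over `ℝ`
  set v : Fin 4 → Matrix (Fin 2) (Fin 2) ℝ := fun i => X.ι (bO i : X.B) with hv
  have hspan : ⊤ ≤ Submodule.span ℝ (Set.range v) := by
    rw [← span_real_range_eq_top X.ι]
    refine Submodule.span_le.mpr ?_
    rintro _ ⟨x, rfl⟩
    have hx : x = ∑ i, (bQ.repr x i) • bQ i := (bQ.sum_repr x).symm
    rw [hx, map_sum]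
    refine Submodule.sum_mem _ fun i _ => ?_
    rw [map_smul, hbQ]
    have : (bQ.repr x i) • X.ι (bO i : X.B) = ((bQ.repr x i : ℚ) : ℝ) • v i := by
      rw [hv]; exact (Rat.cast_smul_eq_qsmul ℝ _ _).symm
    rw [this]
    exact Submodule.smul_mem _ _ (Submodule.subset_span ⟨i, rfl⟩)
  have hcard : Fintype.card (Fin 4) = Module.finrank ℝ (Matrix (Fin 2) (Fin 2) ℝ) := by
    rw [Module.finrank_matrix]; simp
  refine ⟨basisOfTopLeSpanOfCardEqFinrank v hspan hcard, ?_⟩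
  rw [coe_basisOfTopLeSpanOfCardEqFinrank]
  -- `ι(O) = ι(span_ℤ bO) = span_ℤ (ι ∘ bO)`
  have hO : X.O = Submodule.span ℤ (Set.range fun i => (bO i : X.B)) := eq_span_range_basis bO
  have hrange : Set.range v = (X.ι.toLinearMap.restrictScalars ℤ) '' Set.range (fun i => (bO i : X.B)) := by
    ext y
    simp only [Set.mem_range, Set.mem_image, exists_exists_eq_and, hv]
    rfl
  rw [hrange, ← Submodule.map_span, Submodule.map_coe, ← hO]
  rfl

/-! ### 3. `Γ₀^D(M)` is discrete -/

/-- **Vignéras IV Thm. 1.1 (1): `Γ₀^D(M) = ι(O¹)` is a discrete subgroup of `SL₂(ℝ)`** — for every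
`r` only finitely many `γ ∈ ι(O¹)` have `a² + b² + c² + d² ≤ r` (tree `IsDiscreteSubgroup`): such
`γ` lie in the lattice `ι(O)` and in a bounded set. [cite: VignerasLNM800, Ch. IV §1 Thm. 1.1 (1)] -/
theorem ShimuraCurveData.isDiscreteSubgroup_Gamma (X : ShimuraCurveData D M) :
    IsDiscreteSubgroup X.Gamma := by
  intro r
  obtain ⟨b, hb⟩ := X.exists_basis_coe_span_eq
  -- the bounded set `K = {m : |m i j| ≤ √|r| + 1}`
  set K : Set (Matrix (Fin 2) (Fin 2) ℝ) := Metric.closedBall 0 (Real.sqrt |r|) with hK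
  have hfin : Set.Finite (K ∩ Submodule.span ℤ (Set.range b)) :=
    ZSpan.setFinite_inter b Metric.isBounded_closedBall
  -- the map `γ ↦ γ` (as a matrix) sends our set injectively into `K ∩ ι(O)`
  have hsub : {γ : GL (Fin 2) ℝ | γ ∈ X.Gamma ∧
      (γ 0 0 : ℝ) ^ 2 + (γ 0 1 : ℝ) ^ 2 + (γ 1 0 : ℝ) ^ 2 + (γ 1 1 : ℝ) ^ 2 ≤ r} ⊆
      (fun γ : GL (Fin 2) ℝ => (γ : Matrix (Fin 2) (Fin 2) ℝ)) ⁻¹'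
        (K ∩ (Submodule.span ℤ (Set.range b) : Set (Matrix (Fin 2) (Fin 2) ℝ))) := by
    rintro γ ⟨hγ, hr⟩
    refine ⟨?_, ?_⟩
    · -- norm bound
      rw [hK, Metric.mem_closedBall, dist_zero_right]
      have hr0 : 0 ≤ r := le_trans (by positivity) hr
      rw [abs_of_nonneg hr0]
      refine (Matrix.norm_le_iff (Real.sqrt_nonneg r)).mpr fun i j => ?_
      rw [Real.norm_eq_abs, ← Real.sqrt_sq_eq_abs]
      refine Real.sqrt_le_sqrt ?_
      have h00 := sq_nonneg (γ 0 0 : ℝ)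
      have h01 := sq_nonneg (γ 0 1 : ℝ)
      have h10 := sq_nonneg (γ 1 0 : ℝ)
      have h11 := sq_nonneg (γ 1 1 : ℝ)
      fin_cases i <;> fin_cases j
      · change (γ 0 0 : ℝ) ^ 2 ≤ r; linarith
      · change (γ 0 1 : ℝ) ^ 2 ≤ r; linarith
      · change (γ 1 0 : ℝ) ^ 2 ≤ r; linarith
      · change (γ 1 1 : ℝ) ^ 2 ≤ r; linarith
    · -- `γ ∈ ι(O)`
      rw [hb]
      obtain ⟨⟨x, hx, hxγ⟩, -, -⟩ := hγ
      exact ⟨x, hx, hxγ⟩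
  refine Set.Finite.subset (Set.Finite.preimage ?_ hfin) hsub
  exact Set.injOn_of_injective Units.val_injective

end Literature.NumberTheory.Automorphic

end
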